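import Summits.QuantumFields.BalabanUV.Gaps.D1WardSolvableColourSet

/-!
# `BalabanUV.Gaps.D1EndSymmetrySolvableColourSet` — cell pub-balaban-gaps, row (D1), seat g1-p1: THE END's WHOLE SYMMETRY HALF `hW ∧ hR` (AT ONE LEVEL, OR AT EVERY LEVEL) FOR SOME BORDER WEIGHT,
# AS A CONDITION ON PRINT's UNCOMPUTED COLOUR TRIPLE OF THE β-LEAD's PINNED FAMILY, IS VACUOUS OR ALGEBRAIC OF DEGREE ≤ 4 — hypothesis-free off the pin

HONEST FRAMING (cell rule, page 1 of everything): [folklore] algebra BY NAME — GEN 16's `Gaps/D1SymmetryPencil` (defects, pencils, `affine_joint_exists_iff`) and `Gaps/D1WardSolvableColourSet`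
(every Ward-defect entry is a polynomial of total degree ≤ 4 without linear part in the colour triple), GEN 15's entrywise border-affinity ∕ colour-freeness of the unit border tower, GEN 12's
entrywise node laws, GEN 13's packaging lemma.  The printed Ward identity (5.9) and reflection covariance (5.7) [Balaban1987RG1 p. 293] are PREDICATES (`PolarizationSign.WardTransversal ∕
AxisReflectionCovariant`) on members of the cells' OWN pinned family `JsBalAn1(r; c⃗; cE₂; cB; T)` ((P6) undecided); this file records what the END `OneStepKernelFamily.d1Drift_of_D1Tel_D1Rep`'s two
symmetry binders TOGETHER demand of print's UNCOMPUTED colour triple once the border weight is left free, AS ALGEBRA.  Nothing of Bałaban's asserted; NO coefficient computed or signed; (D1) NOT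
discharged; 0∕4 row-D1 binders; NOT `BetaPertH`, NOT continuum, NOT Clay.
HONEST DEPENDENCY (b2b cell, verbatim): «continuum YM on T⁴ ⇐ BetaPertH ∧ nine spine estimates (0/9 proved); BetaPertH ⇐ (D1) ∧ (D4) ∧ CAP+tail; G-an2-4 gates asym, D1 and NE2/3/4.»

CONTENT (all [folklore]; no `def`, 0 sorry): §1 `reflDefect_wsum5`; `reflDefect_flipK_JsBalAn1_line_nodes ∕ _ray_nodes`, **`reflDefect_eq_eval_mvPolynomial`** (every reflection-defect entry
`c⃗ ↦ reflDefect (flipK T_j(c⃗; cB; T)) α μ ν z` is ONE polynomial of total degree ≤ 4 without linear part), `unitBorder_reflDefect_colour_free`; §2 `allColours_or_properAlgebraic_of_family` (bookkeeping),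
**`endSymmetrySolvableOn_allColours_or_properAlgebraic`** (ANY set `J` of levels, one border weight; (56)'s `affine_joint_exists_iff` over the index `(J × Ward entries) ⊕ (J × reflection entries)`), with
corollaries **`endSymmetrySolvable_allColours_or_properAlgebraic`** (ONE level) and **`endSymmetrySolvableAllLevels_allColours_or_properAlgebraic`** (EVERY level): HYPOTHESIS-FREE, `(∀ c⃗, ∃ cB, hW ∧ hR) ∨ ∃ M ≠ 0, M.totalDegree ≤ 4, M.homogeneousComponent 1 = 0,
∀ c⃗, (∃ cB, hW ∧ hR) → eval c⃗ M = 0` (three cases: some unit border tower not Ward-transversal — Ward pivot; all Ward-transversal but one not reflection-covariant — reflection pivot; all both —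
the member `cB = 0` decides); TOPOLOGICAL READING `endSymmetrySolvableOn_allColours_or_fails_in_every_box` (all, or failure inside EVERY box with infinite sides: the colour
triples without such a border weight are then DENSE).

Provenance: cell pub-balaban-gaps, seat g1-p1 GEN 16 (prover-pub-balaban-gaps-g1-p1-g16-0), 2026-08-25; imports `Gaps/D1WardSolvableColourSet` (this seat) only; no existing file touched.
-/

noncomputable section

open Literature.MathematicalPhysics.QuantumFieldTheory Balaban1983to89 Balaban1983to89.Beta
open B6BondElimination (unitVec)
open OneStepResolventKernel (JetData)
open OneStepKernelFamily (TbalOf flipK)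
open PolarizationSign (WardTransversal AxisReflectionCovariant axisReflect reflSign)
open AffineAveraging (box)
open Summit.QuantumFields.BalabanUV.Beta.MixedJetTablesPlug (JsBalAn1)
open Summit.QuantumFields.BalabanUV.Gaps.D1PinnedColourLineReadings (TbalOf_JsBalAn1_line_nodes)
open Summit.QuantumFields.BalabanUV.Gaps.D1PinnedColourRayReadings (TbalOf_JsBalAn1_ray_nodes)
open Summit.QuantumFields.BalabanUV.Gaps.D1PinnedColourPolynomialAlgebra (exists_mvPolynomial_deg_le_four)
open Summit.QuantumFields.BalabanUV.Gaps.D1WardPinsBorderWeight (flipK_TbalOf_JsBalAn1_border_affine unitBorder_colour_free)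
open Summit.QuantumFields.BalabanUV.Gaps.D1SymmetryPencil
open Summit.QuantumFields.BalabanUV.Gaps.D1WardSolvableColourSet (wardDefect_eq_eval_mvPolynomial unitBorder_wardDefect_colour_free mvPolynomial_combination_deg_le_four)

namespace Summit.QuantumFields.BalabanUV.Gaps.D1EndSymmetrySolvableColourSet

/-! ## §1 Reflection-defect entries are polynomials of total degree ≤ 4 without linear part in the colour triple -/

section Generic

variable {d : ℕ}

/-- [folklore] If `P = Σᵢ wᵢ·Pᵢ` entrywise (five kernels), then `reflDefect P α μ ν z = Σᵢ wᵢ · reflDefect Pᵢ α μ ν z`. -/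
theorem reflDefect_wsum5 {P P₀ P₁ P₂ P₃ P₄ : B12Beta.Kernel d} (w₀ w₁ w₂ w₃ w₄ : ℝ)
    (hP : ∀ a b z, P a b z = w₀ * P₀ a b z + w₁ * P₁ a b z + w₂ * P₂ a b z + w₃ * P₃ a b z + w₄ * P₄ a b z) (α μ ν : Fin d) (z : Fin d → ℤ) :
    reflDefect P α μ ν z = w₀ * reflDefect P₀ α μ ν z + w₁ * reflDefect P₁ α μ ν z + w₂ * reflDefect P₂ α μ ν z + w₃ * reflDefect P₃ α μ ν z + w₄ * reflDefect P₄ α μ ν z := by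
  unfold reflDefect
  rw [hP, hP]; ring

end Generic

section Pinned

variable {Lc : ℕ} [NeZero Lc] {r : Fin (3 + 1) → ℕ}

/-- [folklore] THE FIVE-NODE LAW ALONG AN AFFINE LINE OF COLOUR TRIPLES for every reflection-defect entry. -/
theorem reflDefect_flipK_JsBalAn1_line_nodes (hLc : 1 ≤ Lc) (hr : r ∈ box (3 + 1) Lc) (cE₀ cVH₀ cΛ₀ cE₁ cVH₁ cΛ₁ cE₂ cB : ℝ) (T : Fin 4 → Fin 4 → Fin 4 → Fin 4 → ℝ) (j : ℕ)
    (t s₀ s₁ s₂ s₃ s₄ w₀ w₁ w₂ w₃ w₄ : ℝ) (hm0 : w₀ + w₁ + w₂ + w₃ + w₄ = 1) (hm1 : w₀ * s₀ + w₁ * s₁ + w₂ * s₂ + w₃ * s₃ + w₄ * s₄ = t)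
    (hm2 : w₀ * s₀ ^ 2 + w₁ * s₁ ^ 2 + w₂ * s₂ ^ 2 + w₃ * s₃ ^ 2 + w₄ * s₄ ^ 2 = t ^ 2)
    (hm3 : w₀ * s₀ ^ 3 + w₁ * s₁ ^ 3 + w₂ * s₂ ^ 3 + w₃ * s₃ ^ 3 + w₄ * s₄ ^ 3 = t ^ 3) (hm4 : w₀ * s₀ ^ 4 + w₁ * s₁ ^ 4 + w₂ * s₂ ^ 4 + w₃ * s₃ ^ 4 + w₄ * s₄ ^ 4 = t ^ 4)
    (α μ ν : Fin 4) (z : Fin 4 → ℤ) :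
    reflDefect (flipK (TbalOf Lc (JsBalAn1 hLc hr (cE₀ + t * cE₁) (cVH₀ + t * cVH₁) (cΛ₀ + t * cΛ₁) cE₂ cB T) j)) α μ ν z =
      w₀ * reflDefect (flipK (TbalOf Lc (JsBalAn1 hLc hr (cE₀ + s₀ * cE₁) (cVH₀ + s₀ * cVH₁) (cΛ₀ + s₀ * cΛ₁) cE₂ cB T) j)) α μ ν z +
        w₁ * reflDefect (flipK (TbalOf Lc (JsBalAn1 hLc hr (cE₀ + s₁ * cE₁) (cVH₀ + s₁ * cVH₁) (cΛ₀ + s₁ * cΛ₁) cE₂ cB T) j)) α μ ν z +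
        w₂ * reflDefect (flipK (TbalOf Lc (JsBalAn1 hLc hr (cE₀ + s₂ * cE₁) (cVH₀ + s₂ * cVH₁) (cΛ₀ + s₂ * cΛ₁) cE₂ cB T) j)) α μ ν z +
        w₃ * reflDefect (flipK (TbalOf Lc (JsBalAn1 hLc hr (cE₀ + s₃ * cE₁) (cVH₀ + s₃ * cVH₁) (cΛ₀ + s₃ * cΛ₁) cE₂ cB T) j)) α μ ν z +
        w₄ * reflDefect (flipK (TbalOf Lc (JsBalAn1 hLc hr (cE₀ + s₄ * cE₁) (cVH₀ + s₄ * cVH₁) (cΛ₀ + s₄ * cΛ₁) cE₂ cB T) j)) α μ ν z :=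
  reflDefect_wsum5 w₀ w₁ w₂ w₃ w₄ (fun a b w => by
      simp only [OneStepKernelFamily.flipK_apply]
      exact TbalOf_JsBalAn1_line_nodes hLc hr cE₀ cVH₀ cΛ₀ cE₁ cVH₁ cΛ₁ cE₂ cB T j t s₀ s₁ s₂ s₃ s₄ w₀ w₁ w₂ w₃ w₄ hm0 hm1 hm2 hm3 hm4 a b (-w)) α μ ν z

/-- [folklore] THE FOUR-NODE LAW ALONG A COLOUR RAY for every reflection-defect entry. -/
theorem reflDefect_flipK_JsBalAn1_ray_nodes (hLc : 1 ≤ Lc) (hr : r ∈ box (3 + 1) Lc) (cE cVH cΛ cE₂ cB : ℝ) (T : Fin 4 → Fin 4 → Fin 4 → Fin 4 → ℝ) (j : ℕ)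
    (t s₀ s₁ s₂ s₃ s₄ w₀ w₁ w₂ w₃ w₄ : ℝ) (hm0 : w₀ + w₁ + w₂ + w₃ + w₄ = 1) (hm2 : w₀ * s₀ ^ 2 + w₁ * s₁ ^ 2 + w₂ * s₂ ^ 2 + w₃ * s₃ ^ 2 + w₄ * s₄ ^ 2 = t ^ 2)
    (hm3 : w₀ * s₀ ^ 3 + w₁ * s₁ ^ 3 + w₂ * s₂ ^ 3 + w₃ * s₃ ^ 3 + w₄ * s₄ ^ 3 = t ^ 3) (hm4 : w₀ * s₀ ^ 4 + w₁ * s₁ ^ 4 + w₂ * s₂ ^ 4 + w₃ * s₃ ^ 4 + w₄ * s₄ ^ 4 = t ^ 4)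
    (α μ ν : Fin 4) (z : Fin 4 → ℤ) :
    reflDefect (flipK (TbalOf Lc (JsBalAn1 hLc hr (t * cE) (t * cVH) (t * cΛ) cE₂ cB T) j)) α μ ν z =
      w₀ * reflDefect (flipK (TbalOf Lc (JsBalAn1 hLc hr (s₀ * cE) (s₀ * cVH) (s₀ * cΛ) cE₂ cB T) j)) α μ ν z +
        w₁ * reflDefect (flipK (TbalOf Lc (JsBalAn1 hLc hr (s₁ * cE) (s₁ * cVH) (s₁ * cΛ) cE₂ cB T) j)) α μ ν z +
        w₂ * reflDefect (flipK (TbalOf Lc (JsBalAn1 hLc hr (s₂ * cE) (s₂ * cVH) (s₂ * cΛ) cE₂ cB T) j)) α μ ν z +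
        w₃ * reflDefect (flipK (TbalOf Lc (JsBalAn1 hLc hr (s₃ * cE) (s₃ * cVH) (s₃ * cΛ) cE₂ cB T) j)) α μ ν z +
        w₄ * reflDefect (flipK (TbalOf Lc (JsBalAn1 hLc hr (s₄ * cE) (s₄ * cVH) (s₄ * cΛ) cE₂ cB T) j)) α μ ν z :=
  reflDefect_wsum5 w₀ w₁ w₂ w₃ w₄ (fun a b w => by
      simp only [OneStepKernelFamily.flipK_apply]
      exact TbalOf_JsBalAn1_ray_nodes hLc hr cE cVH cΛ cE₂ cB T j t s₀ s₁ s₂ s₃ s₄ w₀ w₁ w₂ w₃ w₄ hm0 hm2 hm3 hm4 a b (-w)) α μ ν z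

/-- [folklore] **EVERY REFLECTION-DEFECT ENTRY OF A STEP KERNEL IS ONE REAL POLYNOMIAL OF TOTAL DEGREE ≤ 4 WITHOUT LINEAR PART IN THE COLOUR TRIPLE.** -/
theorem reflDefect_eq_eval_mvPolynomial (hLc : 1 ≤ Lc) (hr : r ∈ box (3 + 1) Lc) (cE₂ cB : ℝ) (T : Fin 4 → Fin 4 → Fin 4 → Fin 4 → ℝ) (j : ℕ) (α μ ν : Fin 4) (z : Fin 4 → ℤ) :
    ∃ Q : MvPolynomial (Fin 3) ℝ, Q.totalDegree ≤ 4 ∧ Q.homogeneousComponent 1 = 0 ∧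
      Q.coeff 0 = reflDefect (flipK (TbalOf Lc (JsBalAn1 hLc hr 0 0 0 cE₂ cB T) j)) α μ ν z ∧
      ∀ cE cVH cΛ : ℝ, reflDefect (flipK (TbalOf Lc (JsBalAn1 hLc hr cE cVH cΛ cE₂ cB T) j)) α μ ν z = MvPolynomial.eval ![cE, cVH, cΛ] Q := by
  refine exists_mvPolynomial_deg_le_four (fun cE cVH cΛ => reflDefect (flipK (TbalOf Lc (JsBalAn1 hLc hr cE cVH cΛ cE₂ cB T) j)) α μ ν z)
    (fun cE₀ cVH₀ cΛ₀ cE₁ cVH₁ cΛ₁ t => ?_) (fun cE cVH cΛ t => ?_)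
  · have h := reflDefect_flipK_JsBalAn1_line_nodes hLc hr cE₀ cVH₀ cΛ₀ cE₁ cVH₁ cΛ₁ cE₂ cB T j t 0 1 2 3 4 ((t - 1) * (t - 2) * (t - 3) * (t - 4) / 24)
      (-(t * (t - 2) * (t - 3) * (t - 4) / 6)) (t * (t - 1) * (t - 3) * (t - 4) / 4) (-(t * (t - 1) * (t - 2) * (t - 4) / 6)) (t * (t - 1) * (t - 2) * (t - 3) / 24)
      (by ring) (by ring) (by ring) (by ring) (by ring) α μ ν z
    simp only [zero_mul, one_mul, add_zero] at h
    exact h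
  · have h := reflDefect_flipK_JsBalAn1_ray_nodes hLc hr cE cVH cΛ cE₂ cB T j t 0 1 2 3 0
      (1 - t ^ 2 * (t - 2) * (t - 3) / 2 + t ^ 2 * (t - 1) * (t - 3) / 4 - t ^ 2 * (t - 1) * (t - 2) / 18) (t ^ 2 * (t - 2) * (t - 3) / 2)
      (-(t ^ 2 * (t - 1) * (t - 3) / 4)) (t ^ 2 * (t - 1) * (t - 2) / 18) 0 (by ring) (by ring) (by ring) (by ring) α μ ν z
    simp only [zero_mul, one_mul, add_zero] at h
    exact h

/-- [folklore] The unit border tower's reflection defect is COLOUR-FREE. -/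
theorem unitBorder_reflDefect_colour_free (hLc : 1 ≤ Lc) (hr : r ∈ box (3 + 1) Lc) (cE cVH cΛ cE' cVH' cΛ' cE₂ : ℝ) (T : Fin 4 → Fin 4 → Fin 4 → Fin 4 → ℝ) (j : ℕ) (α μ ν : Fin 4)
    (z : Fin 4 → ℤ) :
    reflDefect (fun a b w => flipK (TbalOf Lc (JsBalAn1 hLc hr cE cVH cΛ cE₂ 1 T) j) a b w - flipK (TbalOf Lc (JsBalAn1 hLc hr cE cVH cΛ cE₂ 0 T) j) a b w) α μ ν z =
      reflDefect (fun a b w => flipK (TbalOf Lc (JsBalAn1 hLc hr cE' cVH' cΛ' cE₂ 1 T) j) a b w - flipK (TbalOf Lc (JsBalAn1 hLc hr cE' cVH' cΛ' cE₂ 0 T) j) a b w) α μ ν z := by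
  unfold reflDefect
  simp only [OneStepKernelFamily.flipK_apply]
  rw [unitBorder_colour_free hLc hr cE cVH cΛ cE' cVH' cΛ' cE₂ T j μ ν, unitBorder_colour_free hLc hr cE cVH cΛ cE' cVH' cΛ' cE₂ T j μ ν (-z)]

/-! ## §2 The END's two symmetry binders TOGETHER, for SOME border weight, as a condition on the colour triple: vacuous or algebraic of degree ≤ 4 -/

/-- [folklore] Bookkeeping: from a family of polynomials deciding a property of colour triples, the dichotomy «all, or a nonzero one». -/
theorem allColours_or_properAlgebraic_of_family {ι : Type*} {S : ℝ → ℝ → ℝ → Prop} (M : ι → MvPolynomial (Fin 3) ℝ)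
    (hM : ∀ i, (M i).totalDegree ≤ 4 ∧ (M i).homogeneousComponent 1 = 0) (key : ∀ cE cVH cΛ : ℝ, S cE cVH cΛ ↔ ∀ i, MvPolynomial.eval ![cE, cVH, cΛ] (M i) = 0) :
    (∀ cE cVH cΛ : ℝ, S cE cVH cΛ) ∨
      ∃ P : MvPolynomial (Fin 3) ℝ, P ≠ 0 ∧ P.totalDegree ≤ 4 ∧ P.homogeneousComponent 1 = 0 ∧ ∀ cE cVH cΛ : ℝ, S cE cVH cΛ → MvPolynomial.eval ![cE, cVH, cΛ] P = 0 := by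
  by_cases hzero : ∀ i, M i = 0
  · exact Or.inl fun cE cVH cΛ => (key cE cVH cΛ).2 fun i => by rw [hzero i, map_zero]
  · obtain ⟨i, hne⟩ : ∃ i, M i ≠ 0 := by
      by_contra hcon
      exact hzero fun i => by by_contra h; exact hcon ⟨i, h⟩
    exact Or.inr ⟨M i, hne, (hM i).1, (hM i).2, fun cE cVH cΛ h => ((key cE cVH cΛ).1 h) i⟩

/-- [folklore] **HYPOTHESIS-FREE: THE END's SYMMETRY HALF AT EVERY LEVEL FOR ONE BORDER WEIGHT, AS A CONDITION ON THE COLOUR TRIPLE, IS VACUOUS OR ALGEBRAIC OF DEGREE ≤ 4** (any `1 ≤ Lc`, box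
root, `cE₂`, table; `J : Set ℕ` any set of levels — `Set.univ` for the END's `∀ j`, a singleton for one level): EITHER every colour triple admits one border weight with `hW_j ∧ hR_j` for all
`j ∈ J`, OR the colour triples that do are zeros of ONE NONZERO real polynomial of total degree ≤ 4 without linear part. -/
theorem endSymmetrySolvableOn_allColours_or_properAlgebraic (hLc : 1 ≤ Lc) (hr : r ∈ box (3 + 1) Lc) (cE₂ : ℝ) (T : Fin 4 → Fin 4 → Fin 4 → Fin 4 → ℝ) (J : Set ℕ) :
    (∀ cE cVH cΛ : ℝ, ∃ cB : ℝ, ∀ j ∈ J, WardTransversal (flipK (TbalOf Lc (JsBalAn1 hLc hr cE cVH cΛ cE₂ cB T) j)) ∧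
        AxisReflectionCovariant (flipK (TbalOf Lc (JsBalAn1 hLc hr cE cVH cΛ cE₂ cB T) j))) ∨
      ∃ M : MvPolynomial (Fin 3) ℝ, M ≠ 0 ∧ M.totalDegree ≤ 4 ∧ M.homogeneousComponent 1 = 0 ∧
        ∀ cE cVH cΛ : ℝ, (∃ cB : ℝ, ∀ j ∈ J, WardTransversal (flipK (TbalOf Lc (JsBalAn1 hLc hr cE cVH cΛ cE₂ cB T) j)) ∧
          AxisReflectionCovariant (flipK (TbalOf Lc (JsBalAn1 hLc hr cE cVH cΛ cE₂ cB T) j))) → MvPolynomial.eval ![cE, cVH, cΛ] M = 0 := by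
  -- the polynomials of the member `cB = 0`: Ward-defect entries `QW j ν z`, reflection-defect entries `QR j α μ ν z`
  have hQW := fun j ν z => wardDefect_eq_eval_mvPolynomial hLc hr cE₂ 0 T j ν z
  choose QW hQW4 hQW1 _hQW0 hQW using hQW
  have hQR := fun j α μ ν z => reflDefect_eq_eval_mvPolynomial hLc hr cE₂ 0 T j α μ ν z
  choose QR hQR4 hQR1 _hQR0 hQR using hQR
  -- the colour-free unit border defects
  set uW : ℕ → Fin 4 → (Fin 4 → ℤ) → ℝ := fun j ν z =>
    wardDefect (fun a b w => flipK (TbalOf Lc (JsBalAn1 hLc hr 0 0 0 cE₂ 1 T) j) a b w - flipK (TbalOf Lc (JsBalAn1 hLc hr 0 0 0 cE₂ 0 T) j) a b w) ν z with huW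
  set uR : ℕ → Fin 4 → Fin 4 → Fin 4 → (Fin 4 → ℤ) → ℝ := fun j α μ ν z =>
    reflDefect (fun a b w => flipK (TbalOf Lc (JsBalAn1 hLc hr 0 0 0 cE₂ 1 T) j) a b w - flipK (TbalOf Lc (JsBalAn1 hLc hr 0 0 0 cE₂ 0 T) j) a b w) α μ ν z with huR
  have hUW : ∀ cE cVH cΛ j ν z, wardDefect (fun a b w => flipK (TbalOf Lc (JsBalAn1 hLc hr cE cVH cΛ cE₂ 1 T) j) a b w - flipK (TbalOf Lc (JsBalAn1 hLc hr cE cVH cΛ cE₂ 0 T) j) a b w) ν z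
      = uW j ν z := fun cE cVH cΛ j ν z => unitBorder_wardDefect_colour_free hLc hr cE cVH cΛ 0 0 0 cE₂ T j ν z
  have hUR : ∀ cE cVH cΛ j α μ ν z, reflDefect (fun a b w => flipK (TbalOf Lc (JsBalAn1 hLc hr cE cVH cΛ cE₂ 1 T) j) a b w -
      flipK (TbalOf Lc (JsBalAn1 hLc hr cE cVH cΛ cE₂ 0 T) j) a b w) α μ ν z = uR j α μ ν z :=
    fun cE cVH cΛ j α μ ν z => unitBorder_reflDefect_colour_free hLc hr cE cVH cΛ 0 0 0 cE₂ T j α μ ν z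
  have hP : ∀ cE cVH cΛ j c a b w, flipK (TbalOf Lc (JsBalAn1 hLc hr cE cVH cΛ cE₂ c T) j) a b w = flipK (TbalOf Lc (JsBalAn1 hLc hr cE cVH cΛ cE₂ 0 T) j) a b w +
      c * (fun a' b' w' => flipK (TbalOf Lc (JsBalAn1 hLc hr cE cVH cΛ cE₂ 1 T) j) a' b' w' - flipK (TbalOf Lc (JsBalAn1 hLc hr cE cVH cΛ cE₂ 0 T) j) a' b' w') a b w :=
    fun cE cVH cΛ j c a b w => flipK_TbalOf_JsBalAn1_border_affine hLc hr cE cVH cΛ cE₂ c T j a b w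
  -- the joint condition at `(c⃗, cB)` as ONE affine system over the index `(levels in J × Ward entries) ⊕ (levels in J × reflection entries)`
  let ιW := {j : ℕ // j ∈ J} × Fin 4 × (Fin 4 → ℤ)
  let ιR := {j : ℕ // j ∈ J} × Fin 4 × Fin 4 × Fin 4 × (Fin 4 → ℤ)
  let fW : ℝ → ℝ → ℝ → ιW → ℝ := fun cE cVH cΛ x => MvPolynomial.eval ![cE, cVH, cΛ] (QW x.1.1 x.2.1 x.2.2)
  let gW : ιW → ℝ := fun x => uW x.1.1 x.2.1 x.2.2
  let fR : ℝ → ℝ → ℝ → ιR → ℝ := fun cE cVH cΛ x => MvPolynomial.eval ![cE, cVH, cΛ] (QR x.1.1 x.2.1 x.2.2.1 x.2.2.2.1 x.2.2.2.2)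
  let gR : ιR → ℝ := fun x => uR x.1.1 x.2.1 x.2.2.1 x.2.2.2.1 x.2.2.2.2
  have key0 : ∀ cE cVH cΛ cB, (∀ j ∈ J, WardTransversal (flipK (TbalOf Lc (JsBalAn1 hLc hr cE cVH cΛ cE₂ cB T) j)) ∧
      AxisReflectionCovariant (flipK (TbalOf Lc (JsBalAn1 hLc hr cE cVH cΛ cE₂ cB T) j))) ↔
      (∀ x : ιW, fW cE cVH cΛ x + cB * gW x = 0) ∧ ∀ x : ιR, fR cE cVH cΛ x + cB * gR x = 0 := by
    intro cE cVH cΛ cB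
    have eW : ∀ j, WardTransversal (flipK (TbalOf Lc (JsBalAn1 hLc hr cE cVH cΛ cE₂ cB T) j)) ↔ ∀ ν z, MvPolynomial.eval ![cE, cVH, cΛ] (QW j ν z) + cB * uW j ν z = 0 := by
      intro j
      rw [wardTransversal_iff]
      refine forall₂_congr fun ν z => ?_
      rw [wardDefect_pencil (hP cE cVH cΛ j cB) ν z, hUW, hQW j ν z cE cVH cΛ]
    have eR : ∀ j, AxisReflectionCovariant (flipK (TbalOf Lc (JsBalAn1 hLc hr cE cVH cΛ cE₂ cB T) j)) ↔
        ∀ α μ ν z, MvPolynomial.eval ![cE, cVH, cΛ] (QR j α μ ν z) + cB * uR j α μ ν z = 0 := by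
      intro j
      rw [axisReflectionCovariant_iff]
      refine forall_congr' fun α => forall₃_congr fun μ ν z => ?_
      rw [reflDefect_pencil (hP cE cVH cΛ j cB) α μ ν z, hUR, hQR j α μ ν z cE cVH cΛ]
    constructor
    · intro h
      exact ⟨fun x => ((eW x.1.1).1 (h x.1.1 x.1.2).1) x.2.1 x.2.2, fun x => ((eR x.1.1).1 (h x.1.1 x.1.2).2) x.2.1 x.2.2.1 x.2.2.2.1 x.2.2.2.2⟩
    · rintro ⟨hW, hR⟩ j hj
      exact ⟨(eW j).2 fun ν z => hW (⟨j, hj⟩, ν, z), (eR j).2 fun α μ ν z => hR (⟨j, hj⟩, α, μ, ν, z)⟩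
  by_cases hUWne : ∃ x : ιW, gW x ≠ 0
  · -- CASE 1: a Ward pivot
    obtain ⟨x₀, hx₀⟩ := hUWne
    refine allColours_or_properAlgebraic_of_family (ι := ιW ⊕ ιR)
      (Sum.elim (fun x => MvPolynomial.C (gW x₀) * QW x.1.1 x.2.1 x.2.2 - MvPolynomial.C (gW x) * QW x₀.1.1 x₀.2.1 x₀.2.2)
        (fun x => MvPolynomial.C (gW x₀) * QR x.1.1 x.2.1 x.2.2.1 x.2.2.2.1 x.2.2.2.2 - MvPolynomial.C (gR x) * QW x₀.1.1 x₀.2.1 x₀.2.2))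
      (fun i => ?_) (fun cE cVH cΛ => ?_)
    · rcases i with x | x
      · exact mvPolynomial_combination_deg_le_four (hQW4 _ _ _) (hQW1 _ _ _) (hQW4 _ _ _) (hQW1 _ _ _) _ _
      · exact mvPolynomial_combination_deg_le_four (hQR4 _ _ _ _ _) (hQR1 _ _ _ _ _) (hQW4 _ _ _) (hQW1 _ _ _) _ _
    · rw [exists_congr (key0 cE cVH cΛ), affine_joint_exists_iff (f₀ := fW cE cVH cΛ) (g := gW) (f₀' := fR cE cVH cΛ) (g' := gR) hx₀, Sum.forall]
      refine and_congr (forall_congr' fun x => ?_) (forall_congr' fun x => ?_)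
      · simp only [Sum.elim_inl, map_sub, map_mul, MvPolynomial.eval_C, fW, sub_eq_zero]
        constructor
        · intro h; linear_combination h
        · intro h; linear_combination h
      · simp only [Sum.elim_inr, map_sub, map_mul, MvPolynomial.eval_C, fW, fR, sub_eq_zero]
        constructor
        · intro h; linear_combination h
        · intro h; linear_combination h
  · by_cases hURne : ∃ x : ιR, gR x ≠ 0
    · -- CASE 2: every unit border Ward defect on `J` vanishes; a reflection pivot
      obtain ⟨x₀, hx₀⟩ := hURne
      have hgW : ∀ x : ιW, gW x = 0 := fun x => by by_contra h; exact hUWne ⟨x, h⟩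
      refine allColours_or_properAlgebraic_of_family (ι := ιR ⊕ ιW)
        (Sum.elim (fun x => MvPolynomial.C (gR x₀) * QR x.1.1 x.2.1 x.2.2.1 x.2.2.2.1 x.2.2.2.2 - MvPolynomial.C (gR x) * QR x₀.1.1 x₀.2.1 x₀.2.2.1 x₀.2.2.2.1 x₀.2.2.2.2)
          (fun x => QW x.1.1 x.2.1 x.2.2))
        (fun i => ?_) (fun cE cVH cΛ => ?_)
      · rcases i with x | x
        · exact mvPolynomial_combination_deg_le_four (hQR4 _ _ _ _ _) (hQR1 _ _ _ _ _) (hQR4 _ _ _ _ _) (hQR1 _ _ _ _ _) _ _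
        · exact ⟨hQW4 _ _ _, hQW1 _ _ _⟩
      · rw [exists_congr (key0 cE cVH cΛ)]
        -- swap the two systems and use the reflection pivot; the Ward system has zero slope
        have hswap : (∃ cB : ℝ, (∀ x : ιW, fW cE cVH cΛ x + cB * gW x = 0) ∧ ∀ x : ιR, fR cE cVH cΛ x + cB * gR x = 0) ↔
            ∃ cB : ℝ, (∀ x : ιR, fR cE cVH cΛ x + cB * gR x = 0) ∧ ∀ x : ιW, fW cE cVH cΛ x + cB * gW x = 0 :=
          exists_congr fun _ => and_comm
        rw [hswap, affine_joint_exists_iff (f₀ := fR cE cVH cΛ) (g := gR) (f₀' := fW cE cVH cΛ) (g' := gW) hx₀, Sum.forall]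
        refine and_congr (forall_congr' fun x => ?_) (forall_congr' fun x => ?_)
        · simp only [Sum.elim_inl, map_sub, map_mul, MvPolynomial.eval_C, fR, sub_eq_zero]
          constructor
          · intro h; linear_combination h
          · intro h; linear_combination h
        · simp only [Sum.elim_inr, fW, hgW x, mul_zero]
          constructor
          · intro h
            have := mul_eq_zero.mp h
            exact this.resolve_right hx₀
          · intro h; rw [h, zero_mul]
    · -- CASE 3: every unit border defect on `J` vanishes: the member `cB = 0` decides
      have hgW : ∀ x : ιW, gW x = 0 := fun x => by by_contra h; exact hUWne ⟨x, h⟩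
      have hgR : ∀ x : ιR, gR x = 0 := fun x => by by_contra h; exact hURne ⟨x, h⟩
      refine allColours_or_properAlgebraic_of_family (ι := ιW ⊕ ιR)
        (Sum.elim (fun x => QW x.1.1 x.2.1 x.2.2) (fun x => QR x.1.1 x.2.1 x.2.2.1 x.2.2.2.1 x.2.2.2.2)) (fun i => ?_) (fun cE cVH cΛ => ?_)
      · rcases i with x | x
        · exact ⟨hQW4 _ _ _, hQW1 _ _ _⟩
        · exact ⟨hQR4 _ _ _ _ _, hQR1 _ _ _ _ _⟩
      · rw [exists_congr (key0 cE cVH cΛ), Sum.forall]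
        simp only [Sum.elim_inl, Sum.elim_inr, hgW, hgR, mul_zero, add_zero, fW, fR]
        constructor
        · rintro ⟨_, h⟩; exact h
        · intro h; exact ⟨0, h⟩

/-- [folklore] **ONE LEVEL**: `(∀ c⃗, ∃ cB, hW_j ∧ hR_j) ∨ (∃ M ≠ 0, deg ≤ 4, no linear part, ∀ c⃗, (∃ cB, hW_j ∧ hR_j) → eval c⃗ M = 0)`. -/
theorem endSymmetrySolvable_allColours_or_properAlgebraic (hLc : 1 ≤ Lc) (hr : r ∈ box (3 + 1) Lc) (cE₂ : ℝ) (T : Fin 4 → Fin 4 → Fin 4 → Fin 4 → ℝ) (j : ℕ) :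
    (∀ cE cVH cΛ : ℝ, ∃ cB : ℝ, WardTransversal (flipK (TbalOf Lc (JsBalAn1 hLc hr cE cVH cΛ cE₂ cB T) j)) ∧
        AxisReflectionCovariant (flipK (TbalOf Lc (JsBalAn1 hLc hr cE cVH cΛ cE₂ cB T) j))) ∨
      ∃ M : MvPolynomial (Fin 3) ℝ, M ≠ 0 ∧ M.totalDegree ≤ 4 ∧ M.homogeneousComponent 1 = 0 ∧
        ∀ cE cVH cΛ : ℝ, (∃ cB : ℝ, WardTransversal (flipK (TbalOf Lc (JsBalAn1 hLc hr cE cVH cΛ cE₂ cB T) j)) ∧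
          AxisReflectionCovariant (flipK (TbalOf Lc (JsBalAn1 hLc hr cE cVH cΛ cE₂ cB T) j))) → MvPolynomial.eval ![cE, cVH, cΛ] M = 0 := by
  have h := endSymmetrySolvableOn_allColours_or_properAlgebraic hLc hr cE₂ T {j}
  simp only [Set.mem_singleton_iff, forall_eq] at h
  exact h

/-- [folklore] **EVERY LEVEL, ONE BORDER WEIGHT** (the END's `hW : ∀ j` and `hR : ∀ j` together): the same dichotomy. -/
theorem endSymmetrySolvableAllLevels_allColours_or_properAlgebraic (hLc : 1 ≤ Lc) (hr : r ∈ box (3 + 1) Lc) (cE₂ : ℝ) (T : Fin 4 → Fin 4 → Fin 4 → Fin 4 → ℝ) :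
    (∀ cE cVH cΛ : ℝ, ∃ cB : ℝ, ∀ j, WardTransversal (flipK (TbalOf Lc (JsBalAn1 hLc hr cE cVH cΛ cE₂ cB T) j)) ∧
        AxisReflectionCovariant (flipK (TbalOf Lc (JsBalAn1 hLc hr cE cVH cΛ cE₂ cB T) j))) ∨
      ∃ M : MvPolynomial (Fin 3) ℝ, M ≠ 0 ∧ M.totalDegree ≤ 4 ∧ M.homogeneousComponent 1 = 0 ∧
        ∀ cE cVH cΛ : ℝ, (∃ cB : ℝ, ∀ j, WardTransversal (flipK (TbalOf Lc (JsBalAn1 hLc hr cE cVH cΛ cE₂ cB T) j)) ∧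
          AxisReflectionCovariant (flipK (TbalOf Lc (JsBalAn1 hLc hr cE cVH cΛ cE₂ cB T) j))) → MvPolynomial.eval ![cE, cVH, cΛ] M = 0 := by
  have h := endSymmetrySolvableOn_allColours_or_properAlgebraic hLc hr cE₂ T Set.univ
  simp only [Set.mem_univ, forall_true_left] at h
  exact h

/-- [folklore] **TOPOLOGICAL READING** for any set `J` of levels: EITHER every colour triple admits one border weight with `hW_j ∧ hR_j` on `J`, OR inside EVERY box with infinite sides (in
particular every open box) some colour triple admits NONE — the colour triples without such a border weight are then DENSE (`MvPolynomial.funext_set`). -/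
theorem endSymmetrySolvableOn_allColours_or_fails_in_every_box (hLc : 1 ≤ Lc) (hr : r ∈ box (3 + 1) Lc) (cE₂ : ℝ) (T : Fin 4 → Fin 4 → Fin 4 → Fin 4 → ℝ) (J : Set ℕ)
    (s : Fin 3 → Set ℝ) (hs : ∀ i, (s i).Infinite) :
    (∀ cE cVH cΛ : ℝ, ∃ cB : ℝ, ∀ j ∈ J, WardTransversal (flipK (TbalOf Lc (JsBalAn1 hLc hr cE cVH cΛ cE₂ cB T) j)) ∧
        AxisReflectionCovariant (flipK (TbalOf Lc (JsBalAn1 hLc hr cE cVH cΛ cE₂ cB T) j))) ∨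
      ∃ x : Fin 3 → ℝ, x ∈ Set.pi Set.univ s ∧ ¬ ∃ cB : ℝ, ∀ j ∈ J, WardTransversal (flipK (TbalOf Lc (JsBalAn1 hLc hr (x 0) (x 1) (x 2) cE₂ cB T) j)) ∧
        AxisReflectionCovariant (flipK (TbalOf Lc (JsBalAn1 hLc hr (x 0) (x 1) (x 2) cE₂ cB T) j)) := by
  rcases endSymmetrySolvableOn_allColours_or_properAlgebraic hLc hr cE₂ T J with h | ⟨M, hM0, -, -, hM⟩
  · exact Or.inl h
  · refine Or.inr ?_
    by_contra hcon
    apply hM0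
    refine MvPolynomial.funext_set s hs fun x hx => ?_
    rw [map_zero]
    have hsol : ∃ cB : ℝ, ∀ j ∈ J, WardTransversal (flipK (TbalOf Lc (JsBalAn1 hLc hr (x 0) (x 1) (x 2) cE₂ cB T) j)) ∧
        AxisReflectionCovariant (flipK (TbalOf Lc (JsBalAn1 hLc hr (x 0) (x 1) (x 2) cE₂ cB T) j)) := by
      by_contra h
      exact hcon ⟨x, hx, h⟩
    have hx3 : (![x 0, x 1, x 2] : Fin 3 → ℝ) = x := by
      funext i; fin_cases i <;> rfl
    have h3 := hM (x 0) (x 1) (x 2) hsol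
    rwa [hx3] at h3

end Pinned

end Summit.QuantumFields.BalabanUV.Gaps.D1EndSymmetrySolvableColourSet

end
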